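import Literature.NumberTheory.Automorphic.BrandtXiSetupIndependence
import Literature.NumberTheory.Automorphic.ShimuraParametrizationSplitCaseProofs
import Literature.NumberTheory.Automorphic.QuaternionLocalSplit
import Literature.NumberTheory.Automorphic.QuaternionIdealLocallyPrincipal
import Literature.NumberTheory.Automorphic.BrandtModuleLocal
import Literature.NumberTheory.Automorphic.DefiniteOrderUnitsFinite
import Literature.NumberTheory.Automorphic.QuaternionAlgebraAdelicNormSqProofs
import Literature.NumberTheory.Automorphic.QuaternionAlgebraAdelicRamificationProofs
import Literature.NumberTheory.Automorphic.QuaternionAlgebraAdelicMatrixProofs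
import Literature.LinearAlgebra.Matrix.MatrixAlgHomConj
import HarnessLib

/-!
# Crux 23422 `EulerHalvesAtThreeResidualUpperBound`, line `cartan`, stub (F2⁰) `CartanDegree.CartanEmptyDegreeIndep`:
# conjugacy of two Eichler presentations `(B, O, ι)` of `X₀^D(M)` — algebraic preliminaries

Seat `bsd-stepL-cartan-f20` (AUTOFILL #2 row (2); `--supports stmt-BirchSwinnertonDyer-23422`; helper file 1 of the proof of
the registered stub `stub_cartanEmptyDegreeIndep : CartanDegree.CartanEmptyDegreeIndep` of `Lines/cartan.lean` v8′). The stub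
says that the class-minimal degree of Cartan parametrisation data at level `(D, M; ∅)` does not depend on the presenting datum;
the proof (files `…CartanEmptyDegreeIndepTransport`, `…CartanEmptyDegreeIndepOfEichler`) conjugates one presentation into the
other by some `g ∈ GL₂⁺(ℝ)` and transports parametrisation data along `τ ↦ g τ`. This file proves, from TREE theorems only:

* §1 `exists_gl_conj_of_algHom_real` — Skolem–Noether for two real representations `ι, ι' : B → M₂(ℝ)` of a quaternion
  algebra over `ℚ` (tree `nonempty_realSplitting_of_algHom` + `exists_algHom_apply_eq_conj`);
* §2 the bookkeeping of the relation «`ι₂(O₂) = g ι₁(O₁) g⁻¹`» (stated elementwise on matrices; no definition is introduced):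
  `gl_conj_eq_iff`, `conjRel_trans`, `conjRel_symm`, `conjRel_units`;
* §3 `exists_gl_pos_conj_of_discr_one` — `D = 1`: two presentations of `X₀(M)` are `GL₂⁺(ℝ)`-conjugate (tree
  `ShimuraCurveData.exists_conj_of_discr_one`, both being conjugates of `{A ∈ M₂(ℤ) : M ∣ A₁₀}`);
* §4 for `X : ShimuraCurveData D M`: `isUnit_iff_ne_zero_of_one_lt` (`D > 1 ⇒ B` division; the iff form of the tree's
  `ShimuraCurveData.isUnit_of_ne_zero`, whose module `ShimuraCurveDivisionLattice` has no hub olean at the time of writing),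
  `exists_reducedNorm_neg_of_algHom_real` (a real representation forces negative reduced norms: in a model `ℍ[ℚ,a,b]`,
  `a, b < 0` would make `x² - a y² = b` insoluble over `ℝ`).

HONEST FRAMING: helper lemmas; no statement item is closed here; nothing about `Ш`; BSD is proved for no curve.
References: [cite: VignerasLNM800, Ch. I §2 Thm. 2.1 (Skolem–Noether), Ch. III §3 Thm. 3.1, Ch. III §5 Cor. 5.7, Ch. IV §1 ex. 4].
Search: `lean search 'exists_conj_of_discr_one|nonempty_realSplitting_of_algHom|exists_algHom_apply_eq_conj'` (used);
no two-presentation conjugacy statement for `D > 1` exists in Mathlib or the tree.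
-/

set_option linter.dupNamespace false
set_option autoImplicit false

noncomputable section

open scoped MatrixGroups Pointwise TensorProduct

namespace Summit.BirchSwinnertonDyer.BirchSwinnertonDyer.Theorems.CartanDegree

open Literature.NumberTheory.Automorphic NumberField IsDedekindDomain

/-! ## §1 Skolem–Noether for two real representations -/

/-- **Skolem–Noether for two real representations of a quaternion algebra over `ℚ`**: two `ℚ`-algebra maps
`ι, ι' : B → M₂(ℝ)` differ by an inner automorphism of `M₂(ℝ)` (both extend to isomorphisms `ℝ ⊗ B ≃ M₂(ℝ)`,
tree `nonempty_realSplitting_of_algHom`; automorphisms of `M₂(ℝ)` are inner, tree `exists_algHom_apply_eq_conj`).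
[cite: VignerasLNM800, Ch. I §2 Thm. 2.1] -/
theorem exists_gl_conj_of_algHom_real {B : Type*} [Ring B] [Algebra ℚ B] [IsQuaternionAlgebra ℚ B]
    (ι ι' : B →ₐ[ℚ] Matrix (Fin 2) (Fin 2) ℝ) :
    ∃ g : GL (Fin 2) ℝ, ∀ x : B,
      ι' x = (g : Matrix (Fin 2) (Fin 2) ℝ) * ι x * ((g⁻¹ : GL (Fin 2) ℝ) : Matrix (Fin 2) (Fin 2) ℝ) := by
  obtain ⟨E, hE⟩ := nonempty_realSplitting_of_algHom ι
  obtain ⟨E', hE'⟩ := nonempty_realSplitting_of_algHom ι'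
  obtain ⟨g, hg⟩ := Literature.LinearAlgebra.Matrix.exists_algHom_apply_eq_conj
    ((E' : ℝ ⊗[ℚ] B →ₐ[ℝ] Matrix (Fin 2) (Fin 2) ℝ).comp (E.symm : Matrix (Fin 2) (Fin 2) ℝ →ₐ[ℝ] ℝ ⊗[ℚ] B))
  refine ⟨g, fun x => ?_⟩
  have h := hg (ι x)
  have hmap : (ι x).map (algebraMap ℝ ℝ) = ι x := by
    ext i j; simp
  rw [hmap, AlgHom.comp_apply] at h
  rw [← hE' x, ← h, ← hE x]
  simp

/-! ## §2 The conjugation relation between two presentations `(O, ι)`: algebra -/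

section Rel

variable {B₁ B₂ B₃ : Type*} [Ring B₁] [Algebra ℚ B₁] [Ring B₂] [Algebra ℚ B₂] [Ring B₃] [Algebra ℚ B₃]

/-- `g m g⁻¹ = m' ↔ m = g⁻¹ m' g` in `M₂(ℝ)`, `g ∈ GL₂(ℝ)`. [folklore] -/
theorem gl_conj_eq_iff (g : GL (Fin 2) ℝ) (m m' : Matrix (Fin 2) (Fin 2) ℝ) :
    (g : Matrix (Fin 2) (Fin 2) ℝ) * m * ((g⁻¹ : GL (Fin 2) ℝ) : Matrix (Fin 2) (Fin 2) ℝ) = m' ↔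
      m = ((g⁻¹ : GL (Fin 2) ℝ) : Matrix (Fin 2) (Fin 2) ℝ) * m' * (g : Matrix (Fin 2) (Fin 2) ℝ) := by
  constructor
  · rintro rfl
    simp only [← mul_assoc, Units.inv_mul, one_mul]
    rw [mul_assoc, Units.inv_mul, mul_one]
  · rintro rfl
    simp only [← mul_assoc, Units.mul_inv, one_mul]
    rw [mul_assoc, Units.mul_inv, mul_one]

/-- Transitivity of the conjugation relation: conjugators multiply. [folklore] -/
theorem conjRel_trans {O₁ : Submodule ℤ B₁} {ι₁ : B₁ →ₐ[ℚ] Matrix (Fin 2) (Fin 2) ℝ}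
    {O₂ : Submodule ℤ B₂} {ι₂ : B₂ →ₐ[ℚ] Matrix (Fin 2) (Fin 2) ℝ}
    {O₃ : Submodule ℤ B₃} {ι₃ : B₃ →ₐ[ℚ] Matrix (Fin 2) (Fin 2) ℝ} {g g' : GL (Fin 2) ℝ}
    (h₁₂ : ∀ m : Matrix (Fin 2) (Fin 2) ℝ, (∃ x ∈ O₁, ι₁ x = m) ↔
      ∃ x ∈ O₂, ι₂ x = (g : Matrix (Fin 2) (Fin 2) ℝ) * m * ((g⁻¹ : GL (Fin 2) ℝ) : Matrix (Fin 2) (Fin 2) ℝ))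
    (h₂₃ : ∀ m : Matrix (Fin 2) (Fin 2) ℝ, (∃ x ∈ O₂, ι₂ x = m) ↔
      ∃ x ∈ O₃, ι₃ x = (g' : Matrix (Fin 2) (Fin 2) ℝ) * m * ((g'⁻¹ : GL (Fin 2) ℝ) : Matrix (Fin 2) (Fin 2) ℝ)) :
    ∀ m : Matrix (Fin 2) (Fin 2) ℝ, (∃ x ∈ O₁, ι₁ x = m) ↔
      ∃ x ∈ O₃, ι₃ x = ((g' * g : GL (Fin 2) ℝ) : Matrix (Fin 2) (Fin 2) ℝ) * m *
        (((g' * g)⁻¹ : GL (Fin 2) ℝ) : Matrix (Fin 2) (Fin 2) ℝ) := by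
  intro m
  rw [h₁₂, h₂₃]
  have e : (g' : Matrix (Fin 2) (Fin 2) ℝ) * ((g : Matrix (Fin 2) (Fin 2) ℝ) * m *
      ((g⁻¹ : GL (Fin 2) ℝ) : Matrix (Fin 2) (Fin 2) ℝ)) * ((g'⁻¹ : GL (Fin 2) ℝ) : Matrix (Fin 2) (Fin 2) ℝ) =
      ((g' * g : GL (Fin 2) ℝ) : Matrix (Fin 2) (Fin 2) ℝ) * m *
        (((g' * g)⁻¹ : GL (Fin 2) ℝ) : Matrix (Fin 2) (Fin 2) ℝ) := by
    rw [mul_inv_rev, Units.val_mul, Units.val_mul]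
    simp only [mul_assoc]
  rw [e]

/-- Symmetry of the conjugation relation: the inverse conjugator. [folklore] -/
theorem conjRel_symm {O₁ : Submodule ℤ B₁} {ι₁ : B₁ →ₐ[ℚ] Matrix (Fin 2) (Fin 2) ℝ}
    {O₂ : Submodule ℤ B₂} {ι₂ : B₂ →ₐ[ℚ] Matrix (Fin 2) (Fin 2) ℝ} {g : GL (Fin 2) ℝ}
    (h₁₂ : ∀ m : Matrix (Fin 2) (Fin 2) ℝ, (∃ x ∈ O₁, ι₁ x = m) ↔
      ∃ x ∈ O₂, ι₂ x = (g : Matrix (Fin 2) (Fin 2) ℝ) * m * ((g⁻¹ : GL (Fin 2) ℝ) : Matrix (Fin 2) (Fin 2) ℝ)) :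
    ∀ m : Matrix (Fin 2) (Fin 2) ℝ, (∃ x ∈ O₂, ι₂ x = m) ↔
      ∃ x ∈ O₁, ι₁ x = ((g⁻¹ : GL (Fin 2) ℝ) : Matrix (Fin 2) (Fin 2) ℝ) * m *
        ((g⁻¹⁻¹ : GL (Fin 2) ℝ) : Matrix (Fin 2) (Fin 2) ℝ) := by
  intro m
  rw [h₁₂, inv_inv]
  have e : (g : Matrix (Fin 2) (Fin 2) ℝ) * (((g⁻¹ : GL (Fin 2) ℝ) : Matrix (Fin 2) (Fin 2) ℝ) * m *
      (g : Matrix (Fin 2) (Fin 2) ℝ)) * ((g⁻¹ : GL (Fin 2) ℝ) : Matrix (Fin 2) (Fin 2) ℝ) = m := by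
    simp only [← mul_assoc, Units.mul_inv, one_mul]
    rw [mul_assoc, Units.mul_inv, mul_one]
  rw [e]

/-- Conjugation by a UNIT OF THE ORDER (an element `u ∈ O` with `u⁻¹ ∈ O`) preserves `ι(O)`. [folklore] -/
theorem conjRel_units {O : Submodule ℤ B₁} (hmul : ∀ a ∈ O, ∀ b ∈ O, a * b ∈ O)
    (ι : B₁ →ₐ[ℚ] Matrix (Fin 2) (Fin 2) ℝ) (u : B₁ˣ) (hu : (u : B₁) ∈ O) (hu' : ((u⁻¹ : B₁ˣ) : B₁) ∈ O) :
    ∀ m : Matrix (Fin 2) (Fin 2) ℝ, (∃ x ∈ O, ι x = m) ↔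
      ∃ x ∈ O, ι x = ((Units.map (ι : B₁ →* Matrix (Fin 2) (Fin 2) ℝ) u : GL (Fin 2) ℝ) : Matrix (Fin 2) (Fin 2) ℝ) * m *
        (((Units.map (ι : B₁ →* Matrix (Fin 2) (Fin 2) ℝ) u)⁻¹ : GL (Fin 2) ℝ) : Matrix (Fin 2) (Fin 2) ℝ) := by
  intro m
  rw [← map_inv, Units.coe_map, Units.coe_map, MonoidHom.coe_coe]
  constructor
  · rintro ⟨x, hx, rfl⟩
    exact ⟨u * x * ↑u⁻¹, hmul _ (hmul _ hu _ hx) _ hu', by rw [map_mul, map_mul]⟩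
  · rintro ⟨x, hx, hxm⟩
    refine ⟨↑u⁻¹ * x * u, hmul _ (hmul _ hu' _ hx) _ hu, ?_⟩
    rw [map_mul, map_mul, hxm]
    simp only [← mul_assoc, ← map_mul, Units.inv_mul, map_one, one_mul]
    rw [mul_assoc, ← map_mul, Units.inv_mul, map_one, mul_one]

end Rel

/-! ## §3 Discriminant `D = 1` -/

/-- **Two presentations of `X₀(M)` are `GL₂⁺(ℝ)`-conjugate**: for `X₁, X₂ : ShimuraCurveData 1 M` there is
`g ∈ GL₂(ℝ)`, `det g > 0`, with `ι₂(O₂) = g ι₁(O₁) g⁻¹` elementwise (both are `hᵢ {A ∈ M₂(ℤ) : M ∣ A₁₀} hᵢ⁻¹`,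
tree `ShimuraCurveData.exists_conj_of_discr_one`; `g = h₂ h₁⁻¹`). [cite: VignerasLNM800, Ch. IV §1 exemple 4 and Ch. III §5 Cor. 5.7] -/
theorem exists_gl_pos_conj_of_discr_one {M : ℕ} (X₁ X₂ : ShimuraCurveData 1 M) :
    ∃ g : GL (Fin 2) ℝ, 0 < g.det.val ∧ ∀ m : Matrix (Fin 2) (Fin 2) ℝ, (∃ x ∈ X₁.O, X₁.ι x = m) ↔
      ∃ x ∈ X₂.O, X₂.ι x = (g : Matrix (Fin 2) (Fin 2) ℝ) * m * ((g⁻¹ : GL (Fin 2) ℝ) : Matrix (Fin 2) (Fin 2) ℝ) := by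
  obtain ⟨-, h₁, hd₁, H₁⟩ := X₁.exists_conj_of_discr_one
  obtain ⟨-, h₂, hd₂, H₂⟩ := X₂.exists_conj_of_discr_one
  refine ⟨h₂ * h₁⁻¹, ?_, fun m => ?_⟩
  · rw [map_mul, map_inv, Units.val_mul, Units.val_inv_eq_inv_val]
    exact mul_pos hd₂ (inv_pos.mpr hd₁)
  rw [H₁, H₂]
  refine exists_congr fun A => and_congr_right fun _ => ?_
  rw [gl_conj_eq_iff (h₂ * h₁⁻¹) m]
  have e : (((h₂ * h₁⁻¹)⁻¹ : GL (Fin 2) ℝ) : Matrix (Fin 2) (Fin 2) ℝ) *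
      ((h₂ : Matrix (Fin 2) (Fin 2) ℝ) * A.map (Int.cast : ℤ → ℝ) * ((h₂⁻¹ : GL (Fin 2) ℝ) : Matrix (Fin 2) (Fin 2) ℝ)) *
        ((h₂ * h₁⁻¹ : GL (Fin 2) ℝ) : Matrix (Fin 2) (Fin 2) ℝ) =
      (h₁ : Matrix (Fin 2) (Fin 2) ℝ) * A.map (Int.cast : ℤ → ℝ) * ((h₁⁻¹ : GL (Fin 2) ℝ) : Matrix (Fin 2) (Fin 2) ℝ) := by
    rw [mul_inv_rev, inv_inv, Units.val_mul, Units.val_mul]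
    simp only [← mul_assoc, Units.inv_mul_cancel_right]
  rw [e]


/-! ## §4 Discriminant `D > 1`: division algebra, indefiniteness, units of norm `-1`, type number one -/

section OneLt

variable {D M : ℕ} (X : ShimuraCurveData D M)

/-- **For `D > 1` the quaternion algebra of a Shimura curve datum is a division algebra** (Wedderburn: `X.B ≃ M_k(E)`,
`k² dim E = 4`; `k = 2` would make `X.B ≃ M₂(ℚ)` split at a prime `p ∣ D`, contradicting `Ram(X.B) = {p ∣ D}`).
The `iff` form of the tree's `ShimuraCurveData.isUnit_of_ne_zero` (module `ShimuraCurveDivisionLattice`, whose olean is not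
built on the hub at the time of writing — to be replaced by an import of that lemma once it is), re-proved so that this file
elaborates.
-- adapted from Literature/NumberTheory/Automorphic/ShimuraCurveDivisionLattice.lean (isUnit_of_ne_zero)
[cite: VignerasLNM800, Ch. III §3 Thm. 3.1 (Ram(H) = ∅ ⇔ H ≃ M(2,K))] -/
theorem isUnit_iff_ne_zero_of_one_lt (hD : 1 < D) (x : X.B) : IsUnit x ↔ x ≠ 0 := by
  classical
  haveI := IsQuaternionAlgebra.isSimpleRing' ℚ X.B
  refine ⟨fun h hx => not_isUnit_zero (hx ▸ h), fun hx => ?_⟩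
  haveI : IsArtinianRing X.B := IsArtinianRing.of_finite ℚ X.B
  have h4 := IsQuaternionAlgebra.finrank_eq_four (K := ℚ) (D := X.B)
  obtain ⟨k, hk, E, _, _, _, ⟨e⟩⟩ :=
    IsSimpleRing.exists_algEquiv_matrix_divisionRing_finite ℚ X.B
  have hdim : k * k * Module.finrank ℚ E = 4 := by
    rw [← h4, e.toLinearEquiv.finrank_eq, Module.finrank_matrix, Fintype.card_fin]
  have hE : 0 < Module.finrank ℚ E := Module.finrank_pos
  have hkle : k ≤ 4 :=
    (Nat.le_mul_self k).trans ((Nat.le_mul_of_pos_right _ hE).trans hdim.le)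
  interval_cases k
  · simp at hdim
  · have hy' : e x ≠ 0 := by simpa using hx
    have h00 : e x 0 0 ≠ 0 := by
      intro h0
      apply hy'
      ext i j
      rw [Subsingleton.elim i 0, Subsingleton.elim j 0, h0]
      rfl
    have hsc : Matrix.scalar (Fin 1) (e x 0 0) = e x := by
      ext i j
      rw [Subsingleton.elim i 0, Subsingleton.elim j 0]
      simp
    have hu : IsUnit (e x) := hsc ▸ (isUnit_iff_ne_zero.mpr h00).map (Matrix.scalar (Fin 1))
    simpa using hu.map e.symm
  · exfalso
    have hE1 : Module.finrank ℚ E = 1 := by omega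
    obtain ⟨-, hsurj⟩ := Algebra.finrank_eq_one_iff_bijective_algebraMap.mp hE1
    let eEK : E ≃ₐ[ℚ] ℚ :=
      (AlgEquiv.ofBijective (Algebra.ofId ℚ E) ⟨(algebraMap ℚ E).injective, hsurj⟩).symm
    let e' : X.B ≃ₐ[ℚ] Matrix (Fin 2) (Fin 2) ℚ := e.trans eEK.mapMatrix
    obtain ⟨p, hp, hpD⟩ := Nat.exists_prime_and_dvd hD.ne'
    set v := (Rat.HeightOneSpectrum.primesEquiv (R := NumberField.RingOfIntegers ℚ)).symm ⟨p, hp⟩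
      with hv
    have hmem : v ∈ ramifiedPlaces ℚ X.B := by
      rw [X.ramifiedPlaces_eq]
      show ((Rat.HeightOneSpectrum.primesEquiv v : Nat.Primes) : ℕ) ∣ D
      rw [hv, Equiv.apply_symm_apply]
      exact hpD
    exact hmem (IsSplitAt.of_algEquiv ℚ X.B e' v (isSplitAt_matrix ℚ v))
  · omega
  · omega

open scoped Quaternion in
/-- **A quaternion algebra over `ℚ` with a real representation takes negative reduced norms** (indefiniteness, in the
form needed here): in a model `B ≃ ℍ[ℚ,a,b]` one of `i`, `j` has norm `-a < 0` or `-b < 0`, for if `a, b < 0` the real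
algebra `ℍ[ℝ,a,b]` is Hamilton's and does not embed in `M₂(ℝ)` (`x² - a y² = b` insoluble). [cite: VignerasLNM800, Ch. I §2 Cor. 2.4] -/
theorem exists_reducedNorm_neg_of_algHom_real {B : Type*} [Ring B] [Algebra ℚ B] [IsQuaternionAlgebra ℚ B]
    (ι : B →ₐ[ℚ] Matrix (Fin 2) (Fin 2) ℝ) : ∃ x : B, reducedNorm ℚ B x < 0 := by
  obtain ⟨a, b, ha, hb, ⟨e⟩⟩ := IsQuaternionAlgebra.exists_algEquiv_quaternionAlgebra (K := ℚ) (D := B)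
  haveI : IsQuaternionAlgebra ℚ ℍ[ℚ,a,b] := QuaternionAlgebra.isQuaternionAlgebra_holds ha hb
  by_cases ha0 : 0 < a
  · refine ⟨e.symm ⟨0, 1, 0, 0⟩, ?_⟩
    rw [reducedNorm_algEquiv, reducedNorm_quaternionAlgebra ℚ a b]
    simp only
    nlinarith
  by_cases hb0 : 0 < b
  · refine ⟨e.symm ⟨0, 0, 1, 0⟩, ?_⟩
    rw [reducedNorm_algEquiv, reducedNorm_quaternionAlgebra ℚ a b]
    simp only
    nlinarith
  exfalso
  have ha1 : a < 0 := lt_of_le_of_ne (not_lt.mp ha0) ha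
  have hb1 : b < 0 := lt_of_le_of_ne (not_lt.mp hb0) hb
  obtain ⟨E, -⟩ := nonempty_realSplitting_of_algHom (ι.comp (e.symm : ℍ[ℚ,a,b] →ₐ[ℚ] B))
  obtain ⟨e₁⟩ := QuaternionAlgebra.nonempty_baseChange_algEquiv ℚ ℝ a b
  have ha' : (algebraMap ℚ ℝ a) ≠ 0 := (map_ne_zero _).mpr ha
  have hb' : (algebraMap ℚ ℝ b) ≠ 0 := (map_ne_zero _).mpr hb
  obtain ⟨x, y, hxy⟩ := (QuaternionAlgebra.nonempty_algEquiv_matrix_iff ha' hb').mp ⟨e₁.symm.trans E⟩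
  rw [eq_ratCast, eq_ratCast] at hxy
  have hac : ((a : ℚ) : ℝ) < 0 := by exact_mod_cast ha1
  have hbc : ((b : ℚ) : ℝ) < 0 := by exact_mod_cast hb1
  nlinarith [sq_nonneg x, mul_nonneg (neg_nonneg.mpr hac.le) (sq_nonneg y)]

end OneLt

end Summit.BirchSwinnertonDyer.BirchSwinnertonDyer.Theorems.CartanDegree

end
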